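import Literature.MathematicalPhysics.QuantumFieldTheory.Balaban1983to89.T4CouplingMatching
import Literature.MathematicalPhysics.QuantumFieldTheory.Balaban1983to89.T4BetaStationary

/-!
# Spine/NE4/KingCurrencyPointwise — the King-currency β-side input from POINTWISE convergence: if Bałaban's β-functions merely
# CONVERGE along every fixed coupling history as the cutoff is removed (no rate, no uniformity), node U2's memory companion
# (history moduli with fading memory) upgrades this to the n-shift modulus `UniformShift ω`, `ω → 0` (an Arzelà–Ascoli argument)

Cell `pub-balaban-gaps` (YM blitz G2), seat `ne4` generation 13 (unit `pub-balaban-gaps-ne4-g13`), record `HOME/ne/NE4.md` §5 census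
item (R51); sequel of `Spine/NE4/KingCurrency` (the shape `UniformShift`; node U2 run DIRECTLY on the cutoff pair `(K, K+n)`) and of
the Literature module `T4BetaStationary` (reversed histories `revHist`, `SeqBox`, the age profile of the history moduli).

WHY.  `KingCurrency` ∕ `KingCurrencyWindow` ∕ `KingCurrencyTransport` show that what NE4 is FOR (the apex's `GenFunCauchy` on King's
route) needs from the β-side only `UniformShift ω γ β` with `ω → 0` — uniform (in the gap `n` and in the history) but RATE-FREE
stationarity of `β_k` in the cutoff.  THIS FILE removes the uniformity as well: it is AUTOMATIC from the memory companion that node U2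
consumes anyway.  Precisely (`shift_eventually_small_of_pointwise`): if
  (P) for every box-valued reversed history `h` (`T4BetaStationary.SeqBox γ h`) the real sequence `k ↦ β k (revHist h k)` — the
      β-function at the current scale as the cutoff is pushed up `k` steps along the ultraviolet history `h` — is CAUCHY (equivalently:
      converges; NO rate, NO uniformity in `h`), and
  (M) `HistLipschitz Λ γ β` with `FadingMemory C θ Λ`, `0 ≤ θ < 1` (node U2's history companion, (2a) of the record's minimal interface),
then for every `ε > 0` there is a scale `J` beyond which EVERY n-shift is `≤ ε`:
`|β_{j+n+1}(g_0,…,g_{j+n}) − β_{j+1}(g_n,…,g_{j+n})| ≤ ε` for all `j ≥ J`, all `n`, all `g_0,…,g_{j+n} ∈ ]0,γ]`.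
MECHANISM (Arzelà–Ascoli on the totally bounded box): by fading memory the couplings older than `A` steps move `β_k` by at most
`Cγθ^{A+1}∕(1−θ)` (`T4BetaStationary.sum_profile_le_of_agree`); the young block `]0,γ]^{A+1}` has a finite `γ∕N`-net, on which the
moduli cost `C(γ∕N)∕(1−θ)`; at the finitely many net histories (old block frozen at `γ`) hypothesis (P) gives a common Cauchy threshold;
a `3ε`-chain concludes.  With a uniform bound `|β| ≤ B` on the boxes the ε-form is repackaged as a modulus: `exists_uniformShift_of_pointwise`
— `∃ ω ≥ 0, ω → 0 ∧ UniformShift ω γ β`, the exact input of `KingCurrencyWindow.direct_matching_eventually`.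

WHAT THIS SAYS FOR THE ROW (R51, sharpened).  On King's route the β-side NEED of the apex is: (P) the β-functions HAVE A LIMIT along
every fixed coupling history as the cutoff is removed — the bare existence of the continuum β-functional `T4BetaStationary.betaInf` as a
limit, history by history, with NO rate and NO uniformity — plus the memory companion (M) and the printed-type bound, both already in
node U2's input list.  NE4 (`ScaleShiftRate`: geometric AND uniform) implies (P) (`T4BetaStationary.tendsto_betaInf`); the converse fails
at every rate (`KingCurrency.harmonicOsc_not_scaleShiftRate`).  NE4 PROPER is unchanged (NOT PRINTED, NOT PROVED, DEPENDENT); (P) is NOT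
PRINTED either ([Balaban1987RG1] p. 264 says nothing about the `j`-dependence of `β_{j+1}`), but it is the weakest conceivable form of
«the β-function has a continuum limit», and its located upstream is compactness-grade (η-uniform bounds + identification of the limit of
each one-step object), not an η-difference theory with a rate.

HONEST FRAMING.  Elementary real analysis on hypothesis SHAPES (0 sorry, standard axioms); every β-side shape is an UNPRINTED binder;
nothing of Bałaban's is asserted or instantiated; spine PROVED 0∕9 before and after this file; rung (B)+1 on ONE finite T⁴ — NOT ℝ⁴,
NOT infinite volume, NOT a mass gap, NOT Clay.

References (TYPES only): [Balaban1987RG1] = T. Bałaban, Commun. Math. Phys. **109** (1987) 249–301, §1 p. 264, §5 p. 298;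
[King1986] = C. King, Commun. Math. Phys. **102** (1986) 649–677, Thm 3.4 p. 656, (3.13) p. 657.
-/

noncomputable section

namespace Summit.QuantumFields.BalabanUV.T4Continuum.Spine.NE4.KingCurrencyPointwise

open Finset Filter Topology
open Literature.MathematicalPhysics.QuantumFieldTheory.Balaban1983to89
open Literature.MathematicalPhysics.QuantumFieldTheory.Balaban1983to89.FlowStep
open Literature.MathematicalPhysics.QuantumFieldTheory.Balaban1983to89.T4CouplingMatching
open Literature.MathematicalPhysics.QuantumFieldTheory.Balaban1983to89.T4BetaStationary

/-! ## §1 Bookkeeping: prefixes as reversed histories; the age profile with a frozen old block; the grid rounding -/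

/-- The two prefixes compared by an n-shift are the level-`(j+n)` and level-`j` prefixes of ONE reversed history (pad with `γ` beyond the
bare end). [folklore] -/
theorem revHist_pad_eq (γ : ℝ) (g : ℕ → ℝ) (j n : ℕ) :
    revHist (fun a => if a ≤ j + n then g (j + n - a) else γ) (j + n) = prefixOf g (j + n) ∧
      revHist (fun a => if a ≤ j + n then g (j + n - a) else γ) j = prefixOf (fun i => g (i + n)) j := by
  constructor
  · funext i
    have hi : (i : ℕ) ≤ j + n := Nat.lt_succ_iff.mp i.2
    simp only [revHist_apply, prefixOf_apply, if_pos (Nat.sub_le _ _)]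
    congr 1
    omega
  · funext i
    have hi : (i : ℕ) ≤ j := Nat.lt_succ_iff.mp i.2
    have h1 : j - (i : ℕ) ≤ j + n := by omega
    simp only [revHist_apply, prefixOf_apply, if_pos h1]
    congr 1
    omega

/-- The padded history is box-valued when the prefix is (`γ > 0`). [folklore] -/
theorem seqBox_pad {γ : ℝ} (hγ : 0 < γ) {g : ℕ → ℝ} {N : ℕ} (hg : ∀ i, i ≤ N → 0 < g i ∧ g i ≤ γ) :
    SeqBox γ (fun a => if a ≤ N then g (N - a) else γ) := by
  intro a
  by_cases ha : a ≤ N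
  · simp only [if_pos ha]; exact hg (N - a) (Nat.sub_le _ _)
  · simp only [if_neg ha]; exact ⟨hγ, le_rfl⟩

/-- THE AGE PROFILE WITH A PERTURBED YOUNG BLOCK AND A FROZEN OLD BLOCK: if two box-valued reversed histories are `δ`-close at the
ages `≤ A`, then at every level `k` the β-values differ by at most `C·δ∕(1−θ) + C·γθ^{A+1}∕(1−θ)` (young block through the moduli,
old block through the fading memory — via an intermediate history and `T4BetaStationary.sum_profile_le_of_agree`). [folklore] -/
theorem abs_beta_sub_le_of_young_close {β : HBeta} {γ C θ : ℝ} {Λ : ℕ → ℕ → ℝ} (hθ0 : 0 ≤ θ) (hθ1 : θ < 1)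
    (hL : HistLipschitz Λ γ β) (hΛ : FadingMemory C θ Λ) {h h' : ℕ → ℝ} (hh : SeqBox γ h) (hh' : SeqBox γ h')
    {A : ℕ} {δ : ℝ} (hδ : 0 ≤ δ) (hclose : ∀ a, a ≤ A → |h a - h' a| ≤ δ) (k : ℕ) :
    |β k (revHist h k) - β k (revHist h' k)| ≤ C * (δ / (1 - θ)) + C * (γ * θ ^ (A + 1) / (1 - θ)) := by
  have hC : 0 ≤ C := constant_nonneg_of_fadingMemory hΛ
  have h1θ : 0 < 1 - θ := by linarith
  -- the intermediate history: young block of `h'`, old block of `h`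
  set hm : ℕ → ℝ := fun a => if a ≤ A then h' a else h a with hhm
  have hhm_box : SeqBox γ hm := fun a => by
    by_cases ha : a ≤ A
    · simp only [hhm, if_pos ha]; exact hh' a
    · simp only [hhm, if_neg ha]; exact hh a
  -- `h` vs `hm`: only the young block moves, by `≤ δ` per age
  have hyoung : |β k (revHist h k) - β k (revHist hm k)| ≤ C * (δ / (1 - θ)) := by
    refine (abs_beta_revHist_sub_le_sum hL hΛ hh hhm_box k).trans ?_
    have hterm : ∀ a ∈ range (k + 1), C * θ ^ a * |h a - hm a| ≤ C * δ * θ ^ a := by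
      intro a _
      have hd : |h a - hm a| ≤ δ := by
        by_cases ha : a ≤ A
        · simp only [hhm, if_pos ha]; exact hclose a ha
        · simp only [hhm, if_neg ha, sub_self, abs_zero]; exact hδ
      calc C * θ ^ a * |h a - hm a| ≤ C * θ ^ a * δ :=
            mul_le_mul_of_nonneg_left hd (mul_nonneg hC (pow_nonneg hθ0 _))
        _ = C * δ * θ ^ a := by ring
    refine (Finset.sum_le_sum hterm).trans ?_
    rw [← Finset.mul_sum]
    have hg : ∑ a ∈ range (k + 1), θ ^ a ≤ 1 / (1 - θ) := by
      have h0 : ∑ m ∈ Ico 0 (k + 1), θ ^ m ≤ θ ^ 0 / (1 - θ) := geom_sum_Ico_le_of_lt_one hθ0 hθ1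
      rw [pow_zero] at h0
      rw [Finset.range_eq_Ico]
      exact h0
    calc C * δ * ∑ a ∈ range (k + 1), θ ^ a ≤ C * δ * (1 / (1 - θ)) :=
          mul_le_mul_of_nonneg_left hg (mul_nonneg hC hδ)
      _ = C * (δ / (1 - θ)) := by ring
  -- `hm` vs `h'`: they agree at all ages `< A + 1`
  have hold : |β k (revHist hm k) - β k (revHist h' k)| ≤ C * (γ * θ ^ (A + 1) / (1 - θ)) := by
    refine (abs_beta_revHist_sub_le_sum hL hΛ hhm_box hh' k).trans ?_
    have hagree : ∀ a, a < A + 1 → hm a = h' a := fun a ha => by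
      simp only [hhm, if_pos (Nat.lt_succ_iff.mp ha)]
    have hp := sum_profile_le_of_agree hθ0 hθ1 hhm_box hh' hagree (k + 1)
    have e : ∑ a ∈ range (k + 1), C * θ ^ a * |hm a - h' a| = C * ∑ a ∈ range (k + 1), θ ^ a * |hm a - h' a| := by
      rw [Finset.mul_sum]
      refine Finset.sum_congr rfl fun a _ => ?_
      ring
    rw [e]
    exact mul_le_mul_of_nonneg_left hp hC
  have t := abs_sub_le (β k (revHist h k)) (β k (revHist hm k)) (β k (revHist h' k))
  linarith

/-- THE GRID ROUNDING on `]0,γ]`: for `0 < x ≤ γ` and `N ≥ 1` the ceiling index `m = ⌈x·N∕γ⌉₊` satisfies `1 ≤ m ≤ N` and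
`|x − γ·m∕N| ≤ γ∕N`. [folklore] -/
theorem grid_round {γ x : ℝ} (hγ : 0 < γ) (hx0 : 0 < x) (hxγ : x ≤ γ) {N : ℕ} (hN : 1 ≤ N) :
    1 ≤ ⌈x * N / γ⌉₊ ∧ ⌈x * N / γ⌉₊ ≤ N ∧ |x - γ * (⌈x * N / γ⌉₊ : ℝ) / N| ≤ γ / N := by
  have hNpos : (0 : ℝ) < N := by exact_mod_cast hN
  have hy0 : 0 < x * N / γ := by positivity
  have hyN : x * N / γ ≤ N := by
    rw [div_le_iff₀ hγ]
    nlinarith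
  refine ⟨Nat.one_le_iff_ne_zero.mpr (Nat.pos_iff_ne_zero.mp (Nat.ceil_pos.mpr hy0)), Nat.ceil_le.mpr (by exact_mod_cast hyN), ?_⟩
  have hle : x * N / γ ≤ (⌈x * N / γ⌉₊ : ℝ) := Nat.le_ceil _
  have hlt : (⌈x * N / γ⌉₊ : ℝ) < x * N / γ + 1 := Nat.ceil_lt_add_one hy0.le
  rw [abs_sub_le_iff]
  constructor
  · -- `x − γ m∕N ≤ γ∕N` since `x ≤ γ m ∕ N`
    have : x ≤ γ * (⌈x * N / γ⌉₊ : ℝ) / N := by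
      rw [le_div_iff₀ hNpos]
      have := mul_le_mul_of_nonneg_left hle hγ.le
      rw [mul_div_assoc'] at this
      rw [show γ * (x * N) / γ = x * N by field_simp] at this
      linarith
    have hγN : 0 ≤ γ / N := by positivity
    linarith
  · -- `γ m∕N − x ≤ γ∕N` since `m < x N∕γ + 1`
    have : γ * (⌈x * N / γ⌉₊ : ℝ) / N ≤ x + γ / N := by
      rw [div_le_iff₀ hNpos]
      have := mul_le_mul_of_nonneg_left hlt.le hγ.le
      rw [mul_add, mul_one, mul_div_assoc', show γ * (x * N) / γ = x * N by field_simp] at this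
      rw [add_mul, div_mul_cancel₀ γ hNpos.ne']
      linarith
    linarith

/-! ## §2 Pointwise convergence along every history + the memory companion ⟹ the n-shifts are eventually small, uniformly -/

/-- **THE ARZELÀ–ASCOLI UPGRADE.**  A history-dependent family `β` with node U2's memory companion — `HistLipschitz Λ γ β`,
`FadingMemory C θ Λ`, `0 ≤ θ < 1` — whose β-values CONVERGE (are Cauchy) along EVERY box-valued reversed history `h` as the cutoff
is pushed up (`k ↦ β k (revHist h k)`; NO rate, NO uniformity in `h`) has EVENTUALLY SMALL n-SHIFTS, UNIFORMLY: for every `ε > 0`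
there is `J` with `|β_{j+n+1}(g_0,…,g_{j+n}) − β_{j+1}(g_n,…,g_{j+n})| ≤ ε` for all `j ≥ J`, all `n`, all `g_0,…,g_{j+n} ∈ ]0,γ]`.
(Old couplings frozen by fading memory; a finite `γ∕N`-grid on the young block `]0,γ]^{A+1}`; a common Cauchy threshold over the
finitely many grid histories; a five-term chain.)  Hypotheses about `β` are UNPRINTED binders. [cite: Balaban1987RG1, §1 p.264 and §5 p.298] -/
theorem shift_eventually_small_of_pointwise {β : HBeta} {γ C θ : ℝ} {Λ : ℕ → ℕ → ℝ}
    (hγ : 0 < γ) (hθ0 : 0 ≤ θ) (hθ1 : θ < 1)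
    (hL : HistLipschitz Λ γ β) (hΛ : FadingMemory C θ Λ)
    (hpt : ∀ h : ℕ → ℝ, SeqBox γ h → CauchySeq fun k => β k (revHist h k))
    {ε : ℝ} (hε : 0 < ε) :
    ∃ J : ℕ, ∀ (n j : ℕ) (g : ℕ → ℝ), J ≤ j → (∀ i, i ≤ j + n → 0 < g i ∧ g i ≤ γ) →
      |β (j + n) (prefixOf g (j + n)) - β j (prefixOf (fun i => g (i + n)) j)| ≤ ε := by
  have hC : 0 ≤ C := constant_nonneg_of_fadingMemory hΛ
  have h1θ : 0 < 1 - θ := by linarith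
  have hε5 : 0 < ε / 5 := by positivity
  -- (i) the old block: `C γ θ^{A+1}∕(1−θ) ≤ ε∕5`
  obtain ⟨A, hA⟩ : ∃ A : ℕ, C * (γ * θ ^ (A + 1) / (1 - θ)) ≤ ε / 5 := by
    have ht : Tendsto (fun A : ℕ => C * (γ * θ ^ (A + 1) / (1 - θ))) atTop (𝓝 0) := by
      have h1 := (tendsto_pow_atTop_nhds_zero_of_lt_one hθ0 hθ1).comp (tendsto_add_atTop_nat 1)
      have h2 := (h1.const_mul (C * γ / (1 - θ)))
      rw [mul_zero] at h2
      refine Tendsto.congr (fun A => ?_) h2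
      simp only [Function.comp]
      ring
    obtain ⟨A, hA⟩ := Metric.tendsto_atTop.mp ht (ε / 5) hε5
    refine ⟨A, ?_⟩
    have h := hA A le_rfl
    rw [Real.dist_eq, sub_zero] at h
    exact (le_abs_self _).trans h.le
  -- (ii) the young block: grid mesh `γ∕N ≤ δ` with `C δ∕(1−θ) ≤ ε∕5`
  set δ := ε / 5 * (1 - θ) / (C + 1) with hδ
  have hδpos : 0 < δ := by positivity
  have hCδ : C * (δ / (1 - θ)) ≤ ε / 5 := by
    rw [hδ]
    have hC1 : 0 < C + 1 := by linarith
    rw [show C * (ε / 5 * (1 - θ) / (C + 1) / (1 - θ)) = C / (C + 1) * (ε / 5) by field_simp]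
    have hq : C / (C + 1) ≤ 1 := by rw [div_le_one hC1]; linarith
    calc C / (C + 1) * (ε / 5) ≤ 1 * (ε / 5) := mul_le_mul_of_nonneg_right hq hε5.le
      _ = ε / 5 := one_mul _
  obtain ⟨N, hN1, hNδ⟩ : ∃ N : ℕ, 1 ≤ N ∧ γ / N ≤ δ := by
    obtain ⟨N, hN⟩ := exists_nat_ge (γ / δ)
    refine ⟨N + 1, by omega, ?_⟩
    have hN' : γ / δ ≤ ((N + 1 : ℕ) : ℝ) := hN.trans (by push_cast; linarith)
    have hNpos : (0 : ℝ) < ((N + 1 : ℕ) : ℝ) := by positivity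
    rw [div_le_iff₀ hNpos]
    rw [div_le_iff₀ hδpos] at hN'
    linarith
  have hNpos : (0 : ℝ) < N := by exact_mod_cast hN1
  -- the finitely many grid histories (young block on the grid, old block frozen at `γ`)
  let H : (Fin (A + 1) → Fin N) → ℕ → ℝ := fun q a =>
    if ha : a < A + 1 then γ * (((q ⟨a, ha⟩ : ℕ) : ℝ) + 1) / N else γ
  have hHbox : ∀ q, SeqBox γ (H q) := by
    intro q a
    by_cases ha : a < A + 1
    · simp only [H, dif_pos ha]
      have hq1 : (((q ⟨a, ha⟩ : ℕ) : ℝ) + 1) ≤ N := by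
        have := (q ⟨a, ha⟩).2
        exact_mod_cast this
      have hq0 : (0 : ℝ) < ((q ⟨a, ha⟩ : ℕ) : ℝ) + 1 := by positivity
      constructor
      · positivity
      · rw [div_le_iff₀ hNpos]
        nlinarith
    · simp only [H, dif_neg ha]
      exact ⟨hγ, le_rfl⟩
  -- a common Cauchy threshold over the grid
  have hthr : ∀ q, ∃ T : ℕ, ∀ k, T ≤ k → ∀ m, T ≤ m →
      |β m (revHist (H q) m) - β k (revHist (H q) k)| ≤ ε / 5 := by
    intro q
    obtain ⟨T, hT⟩ := Metric.cauchySeq_iff.1 (hpt (H q) (hHbox q)) (ε / 5) hε5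
    refine ⟨T, fun k hk m hm => ?_⟩
    have h := hT m hm k hk
    rw [Real.dist_eq] at h
    exact h.le
  choose T hT using hthr
  set Tmax := (Finset.univ : Finset (Fin (A + 1) → Fin N)).sup T with hTmax
  have hTle : ∀ q, T q ≤ Tmax := fun q => Finset.le_sup (Finset.mem_univ q)
  refine ⟨Tmax, fun n j g hj hg => ?_⟩
  -- the padded reversed history of run B's prefix, and its grid rounding
  set hB : ℕ → ℝ := fun a => if a ≤ j + n then g (j + n - a) else γ with hhB
  have hBbox : SeqBox γ hB := seqBox_pad hγ hg
  obtain ⟨e1, e2⟩ := revHist_pad_eq γ g j n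
  rw [← e1, ← e2]
  let qB : Fin (A + 1) → Fin N := fun a =>
    ⟨⌈hB a * N / γ⌉₊ - 1, by
      have h := (grid_round hγ (hBbox a).1 (hBbox a).2 hN1).2.1
      omega⟩
  have hclose : ∀ a, a ≤ A → |hB a - H qB a| ≤ δ := by
    intro a ha
    have ha' : a < A + 1 := Nat.lt_succ_iff.mpr ha
    obtain ⟨hm1, _, herr⟩ := grid_round hγ (hBbox a).1 (hBbox a).2 hN1
    have eH : H qB a = γ * (⌈hB a * N / γ⌉₊ : ℝ) / N := by
      simp only [H, dif_pos ha', qB]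
      rw [Nat.cast_sub hm1]
      push_cast
      ring
    rw [eH]
    exact herr.trans hNδ
  -- the five-term chain
  have hjn : Tmax ≤ j + n := by omega
  have d1 := abs_beta_sub_le_of_young_close hθ0 hθ1 hL hΛ hBbox (hHbox qB) hδpos.le hclose (j + n)
  have d3 := abs_beta_sub_le_of_young_close hθ0 hθ1 hL hΛ hBbox (hHbox qB) hδpos.le hclose j
  have d2 := hT qB j ((hTle qB).trans hj) (j + n) ((hTle qB).trans hjn)
  have t1 := abs_sub_le (β (j + n) (revHist hB (j + n))) (β (j + n) (revHist (H qB) (j + n))) (β j (revHist hB j))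
  have t2 := abs_sub_le (β (j + n) (revHist (H qB) (j + n))) (β j (revHist (H qB) j)) (β j (revHist hB j))
  rw [abs_sub_comm] at d3
  linarith

/-- NE4 IMPLIES (P): under `ScaleShiftRate c θ γ β` with `θ < 1` the β-values along every box-valued reversed history CONVERGE
(`T4BetaStationary.tendsto_betaInf`, at geometric rate), hence are Cauchy — (P) is the rate-free, non-uniform shadow of NE4; the
converse fails at every rate (`KingCurrency.harmonicOsc_not_scaleShiftRate`). [folklore] -/
theorem pointwise_of_scaleShiftRate {c θ γ : ℝ} {β : HBeta} (hss : ScaleShiftRate c θ γ β) (hθ1 : θ < 1) :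
    ∀ h : ℕ → ℝ, SeqBox γ h → CauchySeq fun k => β k (revHist h k) :=
  fun _ hh => (tendsto_betaInf hss hθ1 hh).cauchySeq

/-! ## §3 Repackaging as a modulus: the exact input of `KingCurrencyWindow.direct_matching_eventually` -/

/-- **POINTWISE CONVERGENCE ⟹ THE KING-CURRENCY INPUT.**  Under (P) pointwise Cauchy-ness along every box-valued history, (M) the
memory companion with fading memory, and a uniform bound `|β_{k+1}| ≤ B` on the boxes (printed TYPE, [Balaban1987RG1] p. 264 «uniformly
bounded»), there is a modulus `ω ≥ 0` with `ω → 0` and `UniformShift ω γ β` — RATE-FREE, and with NO uniformity assumed in (P).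
(`ω_j` = the supremum of the n-shifts at scale `j`, finite by the bound; `→ 0` by `shift_eventually_small_of_pointwise`.) [folklore] -/
theorem exists_uniformShift_of_pointwise {β : HBeta} {γ C θ B : ℝ} {Λ : ℕ → ℕ → ℝ}
    (hγ : 0 < γ) (hθ0 : 0 ≤ θ) (hθ1 : θ < 1)
    (hL : HistLipschitz Λ γ β) (hΛ : FadingMemory C θ Λ)
    (hbd : ∀ k (v : Fin (k + 1) → ℝ), v ∈ Box γ k → |β k v| ≤ B)
    (hpt : ∀ h : ℕ → ℝ, SeqBox γ h → CauchySeq fun k => β k (revHist h k)) :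
    ∃ ω : ℕ → ℝ, (∀ j, 0 ≤ ω j) ∧ Tendsto ω atTop (𝓝 0) ∧
      ∀ (n j : ℕ) (g : ℕ → ℝ), (∀ i, i ≤ j + n → 0 < g i ∧ g i ≤ γ) →
        |β (j + n) (prefixOf g (j + n)) - β j (prefixOf (fun i => g (i + n)) j)| ≤ ω j := by
  -- the set of n-shifts at scale `j` (with `0` adjoined), bounded by `2B`
  let S : ℕ → Set ℝ := fun j => insert 0 {r | ∃ (n : ℕ) (g : ℕ → ℝ), (∀ i, i ≤ j + n → 0 < g i ∧ g i ≤ γ) ∧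
    r = |β (j + n) (prefixOf g (j + n)) - β j (prefixOf (fun i => g (i + n)) j)|}
  have hB0 : 0 ≤ B := by
    have h := hbd 0 (fun _ => γ) (mem_box.mpr fun _ => ⟨hγ, le_rfl⟩)
    exact (abs_nonneg _).trans h
  have hSbdd : ∀ j, BddAbove (S j) := by
    intro j
    refine ⟨2 * B, fun r hr => ?_⟩
    rcases Set.mem_insert_iff.mp hr with h0 | ⟨n, g, hg, rfl⟩
    · rw [h0]; positivity
    · have hw1 : prefixOf g (j + n) ∈ Box γ (j + n) := prefixOf_mem_box le_rfl hg
      have hw2 : prefixOf (fun i => g (i + n)) j ∈ Box γ j :=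
        prefixOf_mem_box (N := j) le_rfl fun i hi => hg (i + n) (by omega)
      have h1 := hbd _ _ hw1
      have h2 := hbd _ _ hw2
      have t := abs_sub (β (j + n) (prefixOf g (j + n))) (β j (prefixOf (fun i => g (i + n)) j))
      linarith
  have hSne : ∀ j, (S j).Nonempty := fun j => ⟨0, Set.mem_insert _ _⟩
  refine ⟨fun j => sSup (S j), fun j => le_csSup (hSbdd j) (Set.mem_insert _ _), ?_, ?_⟩
  · -- `ω → 0`
    rw [Metric.tendsto_atTop]
    intro ε hε
    obtain ⟨J, hJ⟩ := shift_eventually_small_of_pointwise hγ hθ0 hθ1 hL hΛ hpt (half_pos hε)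
    refine ⟨J, fun j hj => ?_⟩
    have hle : sSup (S j) ≤ ε / 2 := by
      refine csSup_le (hSne j) fun r hr => ?_
      rcases Set.mem_insert_iff.mp hr with h0 | ⟨n, g, hg, rfl⟩
      · rw [h0]; positivity
      · exact hJ n j g hj hg
    have hge : 0 ≤ sSup (S j) := le_csSup (hSbdd j) (Set.mem_insert _ _)
    rw [Real.dist_eq, sub_zero, abs_of_nonneg hge]
    linarith
  · -- the n-shift modulus (`KingCurrency.UniformShift ω γ β`, unfolded)
    intro n j g hg
    exact le_csSup (hSbdd j) (Set.mem_insert_of_mem _ ⟨n, g, hg, rfl⟩)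

end Summit.QuantumFields.BalabanUV.T4Continuum.Spine.NE4.KingCurrencyPointwise
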